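import Summits.AtomisticToContinuum.Crystallization.Theorems.FrustratedLawDichotomyStrainedPatchHomEntrySearch

/-!
# SHARD GLUE for the search certificate: children ⇒ parent at the `searchOK` level, fuel monotonicity, `searchOK ↔ searchLeaves ≠ 0`,
# count additivity, and ADDRESSED sub-boxes (`node`) so that shard certificates and shard counts walk the same boxes by construction

decomp-a2c hand-1 g24 (crux `AperiodicFrustratedLawGap`, stmt-AtomisticToContinuum-27623; critic rows 906 (iv) / 907 (iii)–(iv)).  The `(H)` certificate of
record (`…HomEntryTableP.homFloor_625_of_entrySearches6RBKP3RDTK`) consumes ONE Boolean per family, `searchOK verdict sel fuel 0 root… = true`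
(`…HomEntrySearch`).  On the full fcc root cube that Boolean is too large for one kernel evaluation, so it is to be assembled from SHARDS = the sub-boxes
reached by the first `s` bisections of the SAME deterministic search.  This module supplies the decide-free glue, entirely at the level of `searchOK`
(so the glued root fact is LITERALLY the hypothesis `hF` / `hH` of the certificate theorems — no tree literal, no restatement):

* §1 the two halves of a box under a selector (`loC`, `hiC`, `halfW`), the one-step unfolding `searchOK_succ_iff`, ★ `searchOK_of_halves` (a node passes
  with fuel `f + 1` if its split half-width is even and both halves pass with fuel `f`; primed form with literal child boxes), `searchOK_of_verdict`,
  ★ `searchOK_mono` / `searchOK_of_le` (fuel monotonicity, so shards certified with different fuels glue at the max);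
* §2 the count instrument agrees with the certificate: `searchLeaves_of_verdict`, `searchLeaves_succ_of_not`, ★ `searchLeaves_ne_zero_iff`
  (`searchLeaves … ≠ 0 ↔ searchOK … = true`; the direction `→` of `searchOK` is `…HomEntrySearch.searchOK_of_searchLeaves_ne_zero`), ★ `searchLeaves_eq_add`
  (COUNT ADDITIVITY: a failing-verdict node with even split counts the sum of its halves) — so a sharded native count IS the root count and sizes the shards;
* §3 ADDRESSES: `node sel addr d c w` = the sub-box reached from `(d, c, w)` by the moves `addr : List Bool` read from the END (head = most recent move;
  `false` = lower half, `true` = upper half), `nodeOK` / `nodeLeaves` = `searchOK` / `searchLeaves` at that node, ★ `nodeOK_of_halves` (the children of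
  address `a` are `false :: a` and `true :: a` — syntactic, so generated glue files elaborate by unification alone), `nodeOK_nil`, `nodeLeaves_eq_add`,
  `addrs s` (all addresses of length `s`, the shard list of the census count spec);
* §4 kernel smoke tests (toy verdict): two shards glued to the root agree with the unsharded search; counts add.

All definitions computable; 0 sorry; standard axioms; no instances / notation / `#eval`.  `--supports stmt-AtomisticToContinuum-27623`.
-/

namespace Summit.AtomisticToContinuum.Crystallization.Theorems.FrustratedLawDichotomyStrainedPatchHomEntrySearchShard

open Summit.AtomisticToContinuum.Crystallization.Theorems.FrustratedLawDichotomyStrainedPatchHomEntrySearch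

variable {κ : Type} [DecidableEq κ]

/-! ## §1. Halves, one-step unfolding, children ⇒ parent, fuel monotonicity -/

/-- Centre of the LOWER half of the box `(c, w)` when coordinate `sel d c w` is bisected (exact integer halving). -/
def loC (sel : ℕ → (κ → ℤ) → (κ → ℤ) → κ) (d : ℕ) (c w : κ → ℤ) : κ → ℤ :=
  Function.update c (sel d c w) (c (sel d c w) - w (sel d c w) / 2)

/-- Centre of the UPPER half of the box `(c, w)` when coordinate `sel d c w` is bisected. -/
def hiC (sel : ℕ → (κ → ℤ) → (κ → ℤ) → κ) (d : ℕ) (c w : κ → ℤ) : κ → ℤ :=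
  Function.update c (sel d c w) (c (sel d c w) + w (sel d c w) / 2)

/-- Half-widths of either half of the box `(c, w)` when coordinate `sel d c w` is bisected. -/
def halfW (sel : ℕ → (κ → ℤ) → (κ → ℤ) → κ) (d : ℕ) (c w : κ → ℤ) : κ → ℤ :=
  Function.update w (sel d c w) (w (sel d c w) / 2)

/-- With no fuel the search is the leaf verdict. [formal bookkeeping] -/
theorem searchOK_zero (v : (κ → ℤ) → (κ → ℤ) → Bool) (sel : ℕ → (κ → ℤ) → (κ → ℤ) → κ) (d : ℕ) (c w : κ → ℤ) :
    searchOK v sel 0 d c w = v c w := rfl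

/-- ONE STEP of the search, unfolded: verdict, or (even split ∧ lower half ∧ upper half with one unit of fuel less). [formal bookkeeping] -/
theorem searchOK_succ_iff (v : (κ → ℤ) → (κ → ℤ) → Bool) (sel : ℕ → (κ → ℤ) → (κ → ℤ) → κ) (fuel d : ℕ) (c w : κ → ℤ) :
    searchOK v sel (fuel + 1) d c w = true ↔ v c w = true ∨
      (w (sel d c w) % 2 = 0 ∧ searchOK v sel fuel (d + 1) (loC sel d c w) (halfW sel d c w) = true ∧
        searchOK v sel fuel (d + 1) (hiC sel d c w) (halfW sel d c w) = true) := by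
  unfold loC hiC halfW
  rw [searchOK]
  simp only [Bool.or_eq_true, Bool.and_eq_true, decide_eq_true_eq, and_assoc]

/-- A box whose verdict passes is accepted with any fuel. [formal bookkeeping] -/
theorem searchOK_of_verdict {v : (κ → ℤ) → (κ → ℤ) → Bool} {sel : ℕ → (κ → ℤ) → (κ → ℤ) → κ} {fuel d : ℕ} {c w : κ → ℤ} (h : v c w = true) :
    searchOK v sel fuel d c w = true := by
  cases fuel with
  | zero => rw [searchOK_zero]; exact h
  | succ n => exact (searchOK_succ_iff v sel n d c w).2 (Or.inl h)

/-- ★ **SHARD GLUE (children ⇒ parent)**: if the split half-width is even and BOTH halves pass with fuel `f`, the box passes with fuel `f + 1` — the halves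
being literally the boxes the search itself generates. [formal bookkeeping] -/
theorem searchOK_of_halves {v : (κ → ℤ) → (κ → ℤ) → Bool} {sel : ℕ → (κ → ℤ) → (κ → ℤ) → κ} {fuel d : ℕ} {c w : κ → ℤ}
    (hev : w (sel d c w) % 2 = 0) (hl : searchOK v sel fuel (d + 1) (loC sel d c w) (halfW sel d c w) = true)
    (hr : searchOK v sel fuel (d + 1) (hiC sel d c w) (halfW sel d c w) = true) : searchOK v sel (fuel + 1) d c w = true :=
  (searchOK_succ_iff v sel fuel d c w).2 (Or.inr ⟨hev, hl, hr⟩)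

/-- The same with the split coordinate and the child boxes given as LITERALS (equations dischargeable by `decide`). [formal bookkeeping] -/
theorem searchOK_of_halves' {v : (κ → ℤ) → (κ → ℤ) → Bool} {sel : ℕ → (κ → ℤ) → (κ → ℤ) → κ} {fuel d : ℕ} {c w : κ → ℤ} {k : κ}
    (hk : sel d c w = k) (hev : w k % 2 = 0) {cl cr w' : κ → ℤ} (hcl : cl = Function.update c k (c k - w k / 2))
    (hcr : cr = Function.update c k (c k + w k / 2)) (hw' : w' = Function.update w k (w k / 2))
    (hl : searchOK v sel fuel (d + 1) cl w' = true) (hr : searchOK v sel fuel (d + 1) cr w' = true) : searchOK v sel (fuel + 1) d c w = true := by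
  subst hk hcl hcr hw'
  exact searchOK_of_halves hev hl hr

/-- The converse bookkeeping: a passing node whose verdict FAILS has an even split and two passing halves. [formal bookkeeping] -/
theorem halves_of_searchOK {v : (κ → ℤ) → (κ → ℤ) → Bool} {sel : ℕ → (κ → ℤ) → (κ → ℤ) → κ} {fuel d : ℕ} {c w : κ → ℤ}
    (h : searchOK v sel (fuel + 1) d c w = true) (hv : v c w = false) :
    w (sel d c w) % 2 = 0 ∧ searchOK v sel fuel (d + 1) (loC sel d c w) (halfW sel d c w) = true ∧
      searchOK v sel fuel (d + 1) (hiC sel d c w) (halfW sel d c w) = true := by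
  rcases (searchOK_succ_iff v sel fuel d c w).1 h with h1 | h2
  · rw [hv] at h1
    exact absurd h1 Bool.false_ne_true
  · exact h2

/-- ★ **FUEL MONOTONICITY** (one step): fuel only bounds the depth, so a search passing with fuel `f` passes with fuel `f + 1`. [formal bookkeeping] -/
theorem searchOK_mono {v : (κ → ℤ) → (κ → ℤ) → Bool} {sel : ℕ → (κ → ℤ) → (κ → ℤ) → κ} :
    ∀ {fuel d : ℕ} {c w : κ → ℤ}, searchOK v sel fuel d c w = true → searchOK v sel (fuel + 1) d c w = true
  | 0, _, _, _, h => searchOK_of_verdict (by rwa [searchOK_zero] at h)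
  | n + 1, d, c, w, h => by
    rcases (searchOK_succ_iff v sel n d c w).1 h with hv | ⟨hev, hl, hr⟩
    · exact searchOK_of_verdict hv
    · exact searchOK_of_halves hev (searchOK_mono hl) (searchOK_mono hr)

/-- ★ Fuel monotonicity: `fuel ≤ fuel'`. [formal bookkeeping] -/
theorem searchOK_of_le {v : (κ → ℤ) → (κ → ℤ) → Bool} {sel : ℕ → (κ → ℤ) → (κ → ℤ) → κ} {fuel fuel' d : ℕ} {c w : κ → ℤ} (hle : fuel ≤ fuel')
    (h : searchOK v sel fuel d c w = true) : searchOK v sel fuel' d c w = true := by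
  induction hle with
  | refl => exact h
  | step _ ih => exact searchOK_mono ih

/-! ## §2. The count instrument agrees with the certificate; count additivity -/

/-- With no fuel the count is `1` on a passing verdict and `0` otherwise. [formal bookkeeping] -/
theorem searchLeaves_zero (v : (κ → ℤ) → (κ → ℤ) → Bool) (sel : ℕ → (κ → ℤ) → (κ → ℤ) → κ) (d : ℕ) (c w : κ → ℤ) :
    searchLeaves v sel 0 d c w = if v c w = true then 1 else 0 := rfl

/-- A box whose verdict passes counts ONE leaf, with any fuel. [formal bookkeeping] -/
theorem searchLeaves_of_verdict {v : (κ → ℤ) → (κ → ℤ) → Bool} {sel : ℕ → (κ → ℤ) → (κ → ℤ) → κ} {fuel d : ℕ} {c w : κ → ℤ} (h : v c w = true) :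
    searchLeaves v sel fuel d c w = 1 := by
  cases fuel with
  | zero => rw [searchLeaves_zero, if_pos h]
  | succ n => rw [searchLeaves, if_pos h]

/-- A failing verdict with an ODD split half-width counts `0` (the search fails there). [formal bookkeeping] -/
theorem searchLeaves_succ_of_odd {v : (κ → ℤ) → (κ → ℤ) → Bool} {sel : ℕ → (κ → ℤ) → (κ → ℤ) → κ} {fuel d : ℕ} {c w : κ → ℤ} (hv : v c w = false)
    (hodd : ¬ w (sel d c w) % 2 = 0) : searchLeaves v sel (fuel + 1) d c w = 0 := by
  rw [searchLeaves, hv]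
  simp only [Bool.false_eq_true, ↓reduceIte, hodd]

/-- ONE STEP of the count at a failing verdict with an even split: `0` if either half counts `0`, else the SUM of the halves. [formal bookkeeping] -/
theorem searchLeaves_succ_of_not {v : (κ → ℤ) → (κ → ℤ) → Bool} {sel : ℕ → (κ → ℤ) → (κ → ℤ) → κ} {fuel d : ℕ} {c w : κ → ℤ} (hv : v c w = false)
    (hev : w (sel d c w) % 2 = 0) :
    searchLeaves v sel (fuel + 1) d c w =
      if searchLeaves v sel fuel (d + 1) (loC sel d c w) (halfW sel d c w) = 0 ∨ searchLeaves v sel fuel (d + 1) (hiC sel d c w) (halfW sel d c w) = 0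
      then 0 else searchLeaves v sel fuel (d + 1) (loC sel d c w) (halfW sel d c w) + searchLeaves v sel fuel (d + 1) (hiC sel d c w) (halfW sel d c w) := by
  unfold loC hiC halfW
  rw [searchLeaves, hv]
  simp only [Bool.false_eq_true, ↓reduceIte, hev]
  generalize searchLeaves v sel fuel (d + 1) (Function.update c (sel d c w) (c (sel d c w) - w (sel d c w) / 2))
      (Function.update w (sel d c w) (w (sel d c w) / 2)) = nl
  generalize searchLeaves v sel fuel (d + 1) (Function.update c (sel d c w) (c (sel d c w) + w (sel d c w) / 2))
      (Function.update w (sel d c w) (w (sel d c w) / 2)) = nr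
  rcases nl with _ | nl <;> rcases nr with _ | nr <;> simp

/-- ★ **COUNT ADDITIVITY**: a failing-verdict node with an even split whose halves both count non-zero counts the SUM of its halves — so the shard counts of a
sharded native run add up to the root count. [formal bookkeeping] -/
theorem searchLeaves_eq_add {v : (κ → ℤ) → (κ → ℤ) → Bool} {sel : ℕ → (κ → ℤ) → (κ → ℤ) → κ} {fuel d : ℕ} {c w : κ → ℤ} (hv : v c w = false)
    (hev : w (sel d c w) % 2 = 0) (hl : searchLeaves v sel fuel (d + 1) (loC sel d c w) (halfW sel d c w) ≠ 0)
    (hr : searchLeaves v sel fuel (d + 1) (hiC sel d c w) (halfW sel d c w) ≠ 0) :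
    searchLeaves v sel (fuel + 1) d c w =
      searchLeaves v sel fuel (d + 1) (loC sel d c w) (halfW sel d c w) + searchLeaves v sel fuel (d + 1) (hiC sel d c w) (halfW sel d c w) := by
  rw [searchLeaves_succ_of_not hv hev, if_neg (not_or.2 ⟨hl, hr⟩)]

/-- A passing search counts at least one leaf (converse of `…HomEntrySearch.searchOK_of_searchLeaves_ne_zero`). [formal bookkeeping] -/
theorem searchLeaves_ne_zero_of_searchOK {v : (κ → ℤ) → (κ → ℤ) → Bool} {sel : ℕ → (κ → ℤ) → (κ → ℤ) → κ} :
    ∀ {fuel d : ℕ} {c w : κ → ℤ}, searchOK v sel fuel d c w = true → searchLeaves v sel fuel d c w ≠ 0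
  | 0, d, c, w, h => by
    rw [searchOK_zero] at h
    rw [searchLeaves_zero, if_pos h]
    exact one_ne_zero
  | n + 1, d, c, w, h => by
    by_cases hv : v c w = true
    · rw [searchLeaves_of_verdict hv]
      exact one_ne_zero
    · have hv' : v c w = false := by simpa using hv
      obtain ⟨hev, hl, hr⟩ := halves_of_searchOK h hv'
      rw [searchLeaves_eq_add hv' hev (searchLeaves_ne_zero_of_searchOK hl) (searchLeaves_ne_zero_of_searchOK hr)]
      exact fun h0 => searchLeaves_ne_zero_of_searchOK hl (Nat.eq_zero_of_add_eq_zero_right h0)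

/-- ★ **THE COUNT INSTRUMENT AND THE CERTIFICATE WALK THE SAME TREE**: the native count is non-zero iff the search Boolean passes (same verdict,
selector, fuel, depth, box). [formal bookkeeping] -/
theorem searchLeaves_ne_zero_iff {v : (κ → ℤ) → (κ → ℤ) → Bool} {sel : ℕ → (κ → ℤ) → (κ → ℤ) → κ} {fuel d : ℕ} {c w : κ → ℤ} :
    searchLeaves v sel fuel d c w ≠ 0 ↔ searchOK v sel fuel d c w = true :=
  ⟨searchOK_of_searchLeaves_ne_zero v sel fuel d c w, searchLeaves_ne_zero_of_searchOK⟩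

/-- … equivalently, the count is `0` iff the search fails. [formal bookkeeping] -/
theorem searchLeaves_eq_zero_iff {v : (κ → ℤ) → (κ → ℤ) → Bool} {sel : ℕ → (κ → ℤ) → (κ → ℤ) → κ} {fuel d : ℕ} {c w : κ → ℤ} :
    searchLeaves v sel fuel d c w = 0 ↔ searchOK v sel fuel d c w = false := by
  rw [← Bool.not_eq_true, ← searchLeaves_ne_zero_iff, not_not]

/-- A positive literal count is a passing search (the form a native count run delivers). [formal bookkeeping] -/
theorem searchOK_of_searchLeaves_eq_succ {v : (κ → ℤ) → (κ → ℤ) → Bool} {sel : ℕ → (κ → ℤ) → (κ → ℤ) → κ} {fuel d : ℕ} {c w : κ → ℤ} {n : ℕ}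
    (h : searchLeaves v sel fuel d c w = n + 1) : searchOK v sel fuel d c w = true :=
  searchLeaves_ne_zero_iff.1 (by rw [h]; exact Nat.succ_ne_zero n)

/-! ## §3. Addressed sub-boxes: shards by construction of the same search -/

/-- The child of a node `n = (depth, centre, half-widths)` under the selector: `false` = lower half, `true` = upper half, one level deeper. -/
def child (sel : ℕ → (κ → ℤ) → (κ → ℤ) → κ) (b : Bool) (n : ℕ × (κ → ℤ) × (κ → ℤ)) : ℕ × (κ → ℤ) × (κ → ℤ) :=
  (n.1 + 1, bif b then hiC sel n.1 n.2.1 n.2.2 else loC sel n.1 n.2.1 n.2.2, halfW sel n.1 n.2.1 n.2.2)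

/-- ★ **THE NODE AT ADDRESS `addr`** below `(d, c, w)` under the selector `sel`: `addr : List Bool` is read FROM THE END (the head is the most recent
move; `false` = lower half, `true` = upper half), so the children of address `a` are `false :: a` and `true :: a`.  Returns `(depth, centre, half-widths)`. -/
def node (sel : ℕ → (κ → ℤ) → (κ → ℤ) → κ) : List Bool → ℕ → (κ → ℤ) → (κ → ℤ) → ℕ × (κ → ℤ) × (κ → ℤ)
  | [], d, c, w => (d, c, w)
  | b :: bs, d, c, w => child sel b (node sel bs d c w)

/-- ★ **SHARD CERTIFICATE**: the search Boolean run at the node of address `addr` (same verdict and selector, `fuel` units of fuel there). -/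
def nodeOK (v : (κ → ℤ) → (κ → ℤ) → Bool) (sel : ℕ → (κ → ℤ) → (κ → ℤ) → κ) (fuel : ℕ) (addr : List Bool) (d : ℕ) (c w : κ → ℤ) : Bool :=
  searchOK v sel fuel (node sel addr d c w).1 (node sel addr d c w).2.1 (node sel addr d c w).2.2

/-- ★ **SHARD COUNT**: the leaf count of the search at the node of address `addr` (the census instrument per shard; `0` = the shard FAILS within `fuel`). -/
def nodeLeaves (v : (κ → ℤ) → (κ → ℤ) → Bool) (sel : ℕ → (κ → ℤ) → (κ → ℤ) → κ) (fuel : ℕ) (addr : List Bool) (d : ℕ) (c w : κ → ℤ) : ℕ :=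
  searchLeaves v sel fuel (node sel addr d c w).1 (node sel addr d c w).2.1 (node sel addr d c w).2.2

/-- The split half-width at the node of address `addr` is even (so its two children are an exact bisection), as a Boolean test. -/
def nodeEven (sel : ℕ → (κ → ℤ) → (κ → ℤ) → κ) (addr : List Bool) (d : ℕ) (c w : κ → ℤ) : Bool :=
  decide ((node sel addr d c w).2.2 (sel (node sel addr d c w).1 (node sel addr d c w).2.1 (node sel addr d c w).2.2) % 2 = 0)

/-- The empty address is the box itself: the root shard certificate IS the search Boolean of the certificate theorems. [formal bookkeeping] -/
theorem nodeOK_nil (v : (κ → ℤ) → (κ → ℤ) → Bool) (sel : ℕ → (κ → ℤ) → (κ → ℤ) → κ) (fuel d : ℕ) (c w : κ → ℤ) :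
    nodeOK v sel fuel [] d c w = searchOK v sel fuel d c w := rfl

/-- … and the root shard count is the root count. [formal bookkeeping] -/
theorem nodeLeaves_nil (v : (κ → ℤ) → (κ → ℤ) → Bool) (sel : ℕ → (κ → ℤ) → (κ → ℤ) → κ) (fuel d : ℕ) (c w : κ → ℤ) :
    nodeLeaves v sel fuel [] d c w = searchLeaves v sel fuel d c w := rfl

/-- The lower child of an address is the lower half of its node. [formal bookkeeping] -/
theorem node_cons_false (sel : ℕ → (κ → ℤ) → (κ → ℤ) → κ) (addr : List Bool) (d : ℕ) (c w : κ → ℤ) :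
    node sel (false :: addr) d c w = ((node sel addr d c w).1 + 1, loC sel (node sel addr d c w).1 (node sel addr d c w).2.1 (node sel addr d c w).2.2,
      halfW sel (node sel addr d c w).1 (node sel addr d c w).2.1 (node sel addr d c w).2.2) := rfl

/-- The upper child of an address is the upper half of its node. [formal bookkeeping] -/
theorem node_cons_true (sel : ℕ → (κ → ℤ) → (κ → ℤ) → κ) (addr : List Bool) (d : ℕ) (c w : κ → ℤ) :
    node sel (true :: addr) d c w = ((node sel addr d c w).1 + 1, hiC sel (node sel addr d c w).1 (node sel addr d c w).2.1 (node sel addr d c w).2.2,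
      halfW sel (node sel addr d c w).1 (node sel addr d c w).2.1 (node sel addr d c w).2.2) := rfl

/-- ★★ **SHARD GLUE BY ADDRESS**: a node passes with fuel `f + 1` if its split is even and its two CHILDREN ADDRESSES pass with fuel `f`.  The children
addresses are syntactic (`false :: a`, `true :: a`), so a generated glue file is a chain of this lemma closed by unification and one `decide` each. [formal bookkeeping] -/
theorem nodeOK_of_halves {v : (κ → ℤ) → (κ → ℤ) → Bool} {sel : ℕ → (κ → ℤ) → (κ → ℤ) → κ} {fuel : ℕ} {addr : List Bool} {d : ℕ} {c w : κ → ℤ}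
    (hev : nodeEven sel addr d c w = true) (hl : nodeOK v sel fuel (false :: addr) d c w = true) (hr : nodeOK v sel fuel (true :: addr) d c w = true) :
    nodeOK v sel (fuel + 1) addr d c w = true :=
  searchOK_of_halves (of_decide_eq_true hev) hl hr

/-- Fuel monotonicity at a node. [formal bookkeeping] -/
theorem nodeOK_of_le {v : (κ → ℤ) → (κ → ℤ) → Bool} {sel : ℕ → (κ → ℤ) → (κ → ℤ) → κ} {fuel fuel' : ℕ} {addr : List Bool} {d : ℕ} {c w : κ → ℤ}
    (hle : fuel ≤ fuel') (h : nodeOK v sel fuel addr d c w = true) : nodeOK v sel fuel' addr d c w = true :=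
  searchOK_of_le hle h

/-- ★ A shard certificate from a positive literal shard COUNT (what the native count run reports). [formal bookkeeping] -/
theorem nodeOK_of_nodeLeaves_eq_succ {v : (κ → ℤ) → (κ → ℤ) → Bool} {sel : ℕ → (κ → ℤ) → (κ → ℤ) → κ} {fuel : ℕ} {addr : List Bool} {d : ℕ}
    {c w : κ → ℤ} {n : ℕ} (h : nodeLeaves v sel fuel addr d c w = n + 1) : nodeOK v sel fuel addr d c w = true :=
  searchOK_of_searchLeaves_eq_succ h

/-- The shard count is non-zero iff the shard certificate passes. [formal bookkeeping] -/
theorem nodeLeaves_ne_zero_iff {v : (κ → ℤ) → (κ → ℤ) → Bool} {sel : ℕ → (κ → ℤ) → (κ → ℤ) → κ} {fuel : ℕ} {addr : List Bool} {d : ℕ} {c w : κ → ℤ} :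
    nodeLeaves v sel fuel addr d c w ≠ 0 ↔ nodeOK v sel fuel addr d c w = true :=
  searchLeaves_ne_zero_iff

/-- ★ **SHARD COUNT ADDITIVITY**: at a node whose verdict fails and whose split is even, non-zero children counts add. [formal bookkeeping] -/
theorem nodeLeaves_eq_add {v : (κ → ℤ) → (κ → ℤ) → Bool} {sel : ℕ → (κ → ℤ) → (κ → ℤ) → κ} {fuel : ℕ} {addr : List Bool} {d : ℕ} {c w : κ → ℤ}
    (hv : v (node sel addr d c w).2.1 (node sel addr d c w).2.2 = false) (hev : nodeEven sel addr d c w = true)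
    (hl : nodeLeaves v sel fuel (false :: addr) d c w ≠ 0) (hr : nodeLeaves v sel fuel (true :: addr) d c w ≠ 0) :
    nodeLeaves v sel (fuel + 1) addr d c w = nodeLeaves v sel fuel (false :: addr) d c w + nodeLeaves v sel fuel (true :: addr) d c w :=
  searchLeaves_eq_add hv (of_decide_eq_true hev) hl hr

/-- All `2^s` addresses of length `s` (the shard list at uniform shard depth `s`; lower child before upper child). -/
def addrs : ℕ → List (List Bool)
  | 0 => [[]]
  | s + 1 => ((addrs s).map fun a => false :: a) ++ (addrs s).map fun a => true :: a

/-- There are `2^s` addresses of length `s`. [formal bookkeeping] -/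
theorem length_addrs : ∀ s : ℕ, (addrs s).length = 2 ^ s
  | 0 => rfl
  | s + 1 => by rw [addrs, List.length_append, List.length_map, List.length_map, length_addrs s, Nat.pow_succ]; omega

/-! ## §4. Kernel smoke tests (toy verdict «half-width of coordinate `0` at most `2`» on one coordinate, root half-width `8`) -/

/-- The two depth-1 shards (`[false]`, `[true]`: centres `∓4`, half-width `4`) each pass with fuel `1` and count `2` leaves; glued by `nodeOK_of_halves`
they give the root with fuel `2`, which is the unsharded search Boolean (`nodeOK_nil`), and the counts add to the unsharded count `4`. -/
example : searchOK (fun _ w : Fin 1 → ℤ => decide (w 0 ≤ 2)) (fun _ _ _ => 0) 2 0 (fun _ => 0) (fun _ => 8) = true :=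
  nodeOK_of_halves (addr := []) (by decide +kernel) (by decide +kernel) (by decide +kernel)

example : nodeLeaves (fun _ w : Fin 1 → ℤ => decide (w 0 ≤ 2)) (fun _ _ _ => 0) 1 [false] 0 (fun _ => 0) (fun _ => 8) = 2 ∧
    nodeLeaves (fun _ w : Fin 1 → ℤ => decide (w 0 ≤ 2)) (fun _ _ _ => 0) 1 [true] 0 (fun _ => 0) (fun _ => 8) = 2 ∧
    searchLeaves (fun _ w : Fin 1 → ℤ => decide (w 0 ≤ 2)) (fun _ _ _ => 0) 2 0 (fun _ => 0) (fun _ => 8) = 4 ∧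
    (node (fun _ _ _ => (0 : Fin 1)) [true, false] 0 (fun _ => (0 : ℤ)) (fun _ => 8)).2.1 0 = -2 ∧
    (addrs 2).length = 4 ∧ nodeEven (fun _ _ _ => (0 : Fin 1)) [true] 0 (fun _ => (0 : ℤ)) (fun _ => 8) = true := by
  decide +kernel

/-- Depth-2 shards glued twice: four one-leaf shards with fuel `0` give the root with fuel `2`. -/
example : searchOK (fun _ w : Fin 1 → ℤ => decide (w 0 ≤ 2)) (fun _ _ _ => 0) 2 0 (fun _ => 0) (fun _ => 8) = true :=
  nodeOK_of_halves (addr := []) (by decide +kernel)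
    (nodeOK_of_halves (by decide +kernel) (by decide +kernel) (by decide +kernel))
    (nodeOK_of_halves (by decide +kernel) (by decide +kernel) (by decide +kernel))

/-! ## §5. Materialised (literal) boxes (appended, hand-1 g24)

MEASURED (farm, interpreted `#eval`, the real chain `entryLeafOK6RBKP muRec`, 21-node shard of the pilot box B): the interpreted verdict is dominated by
box-coordinate LOOKUPS, so its cost depends on HOW the box closures are built — literal `if`-chains 8.6 s, monomorphic `Function.update` chains 9.0 s,
IO-materialised arrays 9.2 s, but the generic addressed closures of `node` 60 s and a `let`-tabulated closure 320 s (the kernel, which caches closed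
lookups, is insensitive: 0.9 s/node either way).  Hence native count runs and `native_decide` shard certificates evaluate the search on a MATERIALISED
literal box `(d', c', w')`, and identify it with the addressed node POINTWISE (a handful of closed integer identities, each a cheap kernel `decide`);
the lemmas below make that identification decide-free otherwise. -/

/-- Searches on pointwise-equal boxes agree. [formal bookkeeping] -/
theorem searchOK_congr {v : (κ → ℤ) → (κ → ℤ) → Bool} {sel : ℕ → (κ → ℤ) → (κ → ℤ) → κ} {fuel d : ℕ} {c c' w w' : κ → ℤ}
    (hc : ∀ k, c k = c' k) (hw : ∀ k, w k = w' k) : searchOK v sel fuel d c w = searchOK v sel fuel d c' w' := by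
  rw [funext hc, funext hw]

/-- Counts on pointwise-equal boxes agree. [formal bookkeeping] -/
theorem searchLeaves_congr {v : (κ → ℤ) → (κ → ℤ) → Bool} {sel : ℕ → (κ → ℤ) → (κ → ℤ) → κ} {fuel d : ℕ} {c c' w w' : κ → ℤ}
    (hc : ∀ k, c k = c' k) (hw : ∀ k, w k = w' k) : searchLeaves v sel fuel d c w = searchLeaves v sel fuel d c' w' := by
  rw [funext hc, funext hw]

/-- ★ **A SHARD CERTIFICATE PROVED ON A LITERAL BOX TRANSFERS TO THE ADDRESSED NODE** once depth, centre and half-widths are identified pointwise. [formal bookkeeping] -/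
theorem nodeOK_of_lit {v : (κ → ℤ) → (κ → ℤ) → Bool} {sel : ℕ → (κ → ℤ) → (κ → ℤ) → κ} {fuel : ℕ} {addr : List Bool} {d : ℕ} {c w : κ → ℤ}
    {d' : ℕ} {c' w' : κ → ℤ} (hd : (node sel addr d c w).1 = d') (hc : ∀ k, (node sel addr d c w).2.1 k = c' k)
    (hw : ∀ k, (node sel addr d c w).2.2 k = w' k) (h : searchOK v sel fuel d' c' w' = true) : nodeOK v sel fuel addr d c w = true := by
  unfold nodeOK
  rw [hd, searchOK_congr hc hw]
  exact h

/-- … and the addressed shard COUNT is the count on the literal box. [formal bookkeeping] -/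
theorem nodeLeaves_eq_lit {v : (κ → ℤ) → (κ → ℤ) → Bool} {sel : ℕ → (κ → ℤ) → (κ → ℤ) → κ} {fuel : ℕ} {addr : List Bool} {d : ℕ} {c w : κ → ℤ}
    {d' : ℕ} {c' w' : κ → ℤ} (hd : (node sel addr d c w).1 = d') (hc : ∀ k, (node sel addr d c w).2.1 k = c' k)
    (hw : ∀ k, (node sel addr d c w).2.2 k = w' k) : nodeLeaves v sel fuel addr d c w = searchLeaves v sel fuel d' c' w' := by
  unfold nodeLeaves
  rw [hd, searchLeaves_congr hc hw]

/-- Enumerator for pointwise identities over the nine fcc entry coordinates. [formal bookkeeping] -/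
theorem forall_fin3x3 {P : Fin 3 × Fin 3 → Prop} (h00 : P (0, 0)) (h01 : P (0, 1)) (h02 : P (0, 2)) (h10 : P (1, 0)) (h11 : P (1, 1))
    (h12 : P (1, 2)) (h20 : P (2, 0)) (h21 : P (2, 1)) (h22 : P (2, 2)) : ∀ k, P k := by
  rintro ⟨a, b⟩
  fin_cases a <;> fin_cases b <;> assumption

/-- Enumerator for pointwise identities over the twelve hcp entry + shuffle coordinates. [formal bookkeeping] -/
theorem forall_fin3x3_sum {P : (Fin 3 × Fin 3) ⊕ Fin 3 → Prop} (h : ∀ k : Fin 3 × Fin 3, P (Sum.inl k)) (h0 : P (Sum.inr 0)) (h1 : P (Sum.inr 1))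
    (h2 : P (Sum.inr 2)) : ∀ k, P k := by
  rintro (k | i)
  · exact h k
  · fin_cases i <;> assumption

/-- Smoke test (toy verdict): the shard `[true]` (depth 1, centre `4`, half-width `4`) certified on its LITERAL box, transferred to the address by
`nodeOK_of_lit` with pointwise identities, then glued with the lower shard to the root. -/
example : searchOK (fun _ w : Fin 1 → ℤ => decide (w 0 ≤ 2)) (fun _ _ _ => 0) 2 0 (fun _ => 0) (fun _ => 8) = true :=
  nodeOK_of_halves (addr := []) (by decide +kernel) (by decide +kernel)
    (nodeOK_of_lit (d' := 1) (c' := fun _ => 4) (w' := fun _ => 4) (by decide +kernel) (fun k => by fin_cases k; decide +kernel)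
      (fun k => by fin_cases k; decide +kernel) (by decide +kernel))

end Summit.AtomisticToContinuum.Crystallization.Theorems.FrustratedLawDichotomyStrainedPatchHomEntrySearchShard
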